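import Literature.Analysis.Calculus.RayTaylor
import Literature.Analysis.Complex.SimilarityPrincipleVector
import Literature.Geometry.Symplectic.JHolomorphicFrameReduction
import HarnessLib

/-!
# The order of a `J`-holomorphic curve at a point and its leading term (McDuff 1991, Prop. 2.6)

**Theorem** (D. McDuff, *The local behaviour of holomorphic curves in almost complex
4-manifolds*, J. Differential Geom. 34 (1991), proof of Prop. 2.6, p. 149: "consider the Taylor
expansion `T(f)` of `f` … Since `f` is nonconstant, it follows from Lemma 2.3 that this expansion
is not identically zero. Let `k` be the order of its first nonzero term … the term in `T(f)` of
order `k` is annihilated by `∂̄` and so is a function of `z` alone"; C. Wendl, *Lectures on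
Contact 3-Manifolds, Holomorphic Curves and Intersection Theory* (2020), Cor. B.21 and
Remark B.22; McDuff–Salamon (2012), Lemma 2.4.1 ff.). Let `u : ℂ → G` be smooth and `J`-holomorphic
near `0` for a smooth almost complex structure `J` on the complex vector space `G` with
`J (u 0) = i`, and suppose `u` is not locally constant at `0`. Then there are an integer `k ≥ 1`
(the ORDER of `u` at `0`; `k - 1` is the critical order) and a vector `a ≠ 0` such that all ray
derivatives `(d/dt)^j u(t v)|_{t=0}` of orders `1 ≤ j < k` vanish, and
`(d/dt)^k u(t v)|_{t=0} = k! v^k • a` for every direction `v ∈ ℂ` — i.e. the Taylor expansion of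
`u` at `0` starts with the holomorphic term `z^k • a`.

* `CriticalOrder.exists_rayDeriv_ne_zero` — FINITE ORDER OF VANISHING: some ray derivative of
  some order `≥ 1` is nonzero (else `u - u 0 = O(|z|^N)` for all `N` by Taylor along rays, and the
  holomorphic comparison function of the similarity principle —
  `Literature.Analysis.Complex.exists_holomorphic_comparison_of_norm_dbar_le_normedSpace`, after
  the frame reduction `Literature.Geometry.Symplectic.FrameReduction.exists_frame` of
  `∂_y (u - u 0) = J(u) ∂ₓ (u - u 0)` — would vanish to infinite order, forcing `u ≡ u 0` near `0`);
* `CriticalOrder.exists_order` — the statement above.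

Proof of the angular structure WITHOUT multivariable Taylor polynomials or the symmetry of
higher derivatives: with `n(θ) = (d/dt)^k u(t e^{iθ})|₀`, Taylor along rays gives
`u(re^{iθ}) - u(0) = rᵏ n(θ)/k! + O(r^{k+1})` and `r ∂ᵣu = rᵏ n(θ)/(k-1)! + O(r^{k+1})`; the
`J`-holomorphicity equation in polar form is EXACTLY `∂_θ u = J(u) (r ∂ᵣ u)`, hence
`∂_θ u = rᵏ i n(θ)/(k-1)! + O(r^{k+1})`; integrating in `θ`, dividing by `rᵏ` and letting `r → 0`
yields `n(θ) - n(0) = k i ∫₀^θ n`, so `n' = k i n` and `n(θ) = e^{ikθ} n(0)`, which is the claim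
with `a = n(0)/k!`. Consequences with remainder estimates for `u`, `du`, `d²u` are drawn in
`JHolomorphicCriticalOrderTaylor.lean`.

Everything is proved; no named facts.

## References

* D. McDuff, *The local behaviour of holomorphic curves in almost complex 4-manifolds*,
  J. Differential Geom. 34 (1991) 143–164, Prop. 2.6 (proof, p. 149), Lemma 2.3.
  [McDuff1991LocalBehaviour]
* C. Wendl, *Lectures on Contact 3-Manifolds, Holomorphic Curves and Intersection Theory* (2020),
  App. B, Thm B.20, Cor. B.21, Remark B.22. [Wendl2020]
* D. McDuff, D. Salamon, *J-holomorphic curves and symplectic topology*, 2nd ed. (2012), §2.3,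
  Lemma 2.4.1. [McDuffSalamon2012]
-/

noncomputable section

open scoped ContDiff Topology Nat
open Set Filter Metric Function Complex Finset intervalIntegral
open Literature.Analysis.Calculus

namespace Literature.Geometry.Symplectic

namespace CriticalOrder

variable {G : Type*} [NormedAddCommGroup G] [NormedSpace ℂ G]

/-! ### Ray derivatives of a smooth map `ℂ → G` -/

/-- Smoothness exponents: `j ≤ ∞`. [folklore] -/
theorem natCast_le_infty (j : ℕ) : ((j : ℕ∞) : WithTop ℕ∞) ≤ ∞ := by
  exact_mod_cast le_top

/-- The ray derivatives of positive order in the direction `0` vanish. [folklore] -/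
theorem iteratedDeriv_rayFun_dir_zero {u : ℂ → G} (hu : ContDiff ℝ ∞ u) {j : ℕ} (hj : 1 ≤ j) :
    iteratedDeriv j (rayFun u (0 : ℂ)) 0 = 0 := by
  have h := iteratedDeriv_rayFun_smul_zero hu (1 : ℂ) (natCast_le_infty j) (0 : ℝ)
  rw [zero_smul, zero_pow (by omega), zero_smul] at h
  exact h

/-- Ray derivatives at `0` in the direction `v ≠ 0`, from the unit direction `v / ‖v‖`.
[folklore] -/
theorem iteratedDeriv_rayFun_eq_norm_pow_smul {u : ℂ → G} (hu : ContDiff ℝ ∞ u) (j : ℕ) {v : ℂ}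
    (hv : v ≠ 0) :
    iteratedDeriv j (rayFun u v) 0 =
      ‖v‖ ^ j • iteratedDeriv j (rayFun u ((‖v‖⁻¹ : ℝ) • v)) 0 := by
  have h := iteratedDeriv_rayFun_smul_zero hu ((‖v‖⁻¹ : ℝ) • v) (natCast_le_infty j) ‖v‖
  rw [smul_smul, mul_inv_cancel₀ (norm_ne_zero_iff.mpr hv), one_smul] at h
  exact h

/-- The normalised direction has norm one. [folklore] -/
theorem norm_inv_norm_smul {v : ℂ} (hv : v ≠ 0) : ‖(‖v‖⁻¹ : ℝ) • v‖ = 1 := by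
  rw [norm_smul, norm_inv, norm_norm, inv_mul_cancel₀ (norm_ne_zero_iff.mpr hv)]

/-- If all ray derivatives of orders `1 ≤ j ≤ N` vanish in every unit direction, they vanish in
every direction. [folklore] -/
theorem rayDeriv_eq_zero_of_unit {u : ℂ → G} (hu : ContDiff ℝ ∞ u) {j : ℕ} (hj : 1 ≤ j)
    (h : ∀ v : ℂ, ‖v‖ = 1 → iteratedDeriv j (rayFun u v) 0 = 0) (v : ℂ) :
    iteratedDeriv j (rayFun u v) 0 = 0 := by
  by_cases hv : v = 0
  · rw [hv]; exact iteratedDeriv_rayFun_dir_zero hu hj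
  · rw [iteratedDeriv_rayFun_eq_norm_pow_smul hu j hv, h _ (norm_inv_norm_smul hv), smul_zero]

/-- The top ray derivative at `0` is bounded by `‖D^k u(0)‖ ‖v‖^k`. [folklore] -/
theorem norm_iteratedDeriv_rayFun_zero_le {u : ℂ → G} (hu : ContDiff ℝ ∞ u) (k : ℕ) (v : ℂ) :
    ‖iteratedDeriv k (rayFun u v) 0‖ ≤ ‖iteratedFDeriv ℝ k u 0‖ * ‖v‖ ^ k := by
  have h := norm_iteratedDeriv_rayFun_le hu v (natCast_le_infty k) 0
  rwa [zero_smul] at h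

/-- The ray derivative at `0` as the iterated Fréchet derivative at `0` on the diagonal.
[folklore] -/
theorem iteratedDeriv_rayFun_zero_eq {u : ℂ → G} (hu : ContDiff ℝ ∞ u) (k : ℕ) (v : ℂ) :
    iteratedDeriv k (rayFun u v) 0 = iteratedFDeriv ℝ k u 0 (fun _ => v) := by
  have h := iteratedDeriv_rayFun hu v (natCast_le_infty k) 0
  rwa [zero_smul] at h

/-! ### Finite order of vanishing -/

section FiniteOrder

variable [FiniteDimensional ℂ G]

/-- **Finite order of vanishing of a non-locally-constant `J`-holomorphic curve** (McDuff 1991,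
proof of Prop. 2.6 via Lemma 2.3; Wendl 2020 Cor. B.21). If `u : ℂ → G` is smooth,
`J`-holomorphic on `B(0, R₀)` for a smooth almost complex structure `J` with `J (u 0) = i`, and
not locally constant at `0`, then some ray derivative `(d/dt)^j u(tv)|_{t=0}`, `j ≥ 1`, `‖v‖ = 1`,
is nonzero. [cite: McDuff1991LocalBehaviour, Prop. 2.6 (proof) and Lemma 2.3] -/
theorem exists_rayDeriv_ne_zero {J : G → G →L[ℝ] G} {u : ℂ → G} {R₀ : ℝ} (hR₀ : 0 < R₀)
    (hJ : ContDiff ℝ ∞ J) (hJ2 : ∀ x v, J x (J x v) = -v) (hu : ContDiff ℝ ∞ u)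
    (hhol : ∀ z ∈ ball (0 : ℂ) R₀, ∀ ζ : ℂ, fderiv ℝ u z (I * ζ) = J (u z) (fderiv ℝ u z ζ))
    (hJ0 : ∀ v, J (u 0) v = I • v) (hnc : ∃ᶠ z in 𝓝 (0 : ℂ), u z ≠ u 0) :
    ∃ (j : ℕ) (v : ℂ), 1 ≤ j ∧ ‖v‖ = 1 ∧ iteratedDeriv j (rayFun u v) 0 ≠ 0 := by
  haveI : CompleteSpace G := FiniteDimensional.complete ℂ G
  by_contra H
  push Not at H
  -- all ray derivatives of positive order vanish, in every direction
  have H' : ∀ j : ℕ, 1 ≤ j → ∀ v : ℂ, iteratedDeriv j (rayFun u v) 0 = 0 := fun j hj =>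
    rayDeriv_eq_zero_of_unit hu hj (fun v hv => H j v hj hv)
  -- hence `u - u 0 = O(‖z‖^{N+1})` on the unit disc, for every `N`
  have hflat : ∀ N : ℕ, ∃ C : ℝ, ∀ z ∈ closedBall (0 : ℂ) 1, ‖u z - u 0‖ ≤ C * ‖z‖ ^ (N + 1) := by
    intro N
    have hcont : Continuous fun x => iteratedFDeriv ℝ (N + 1) u x :=
      hu.continuous_iteratedFDeriv (natCast_le_infty _)
    obtain ⟨K, hK⟩ := (isCompact_closedBall (0 : ℂ) 1).exists_bound_of_continuousOn
      hcont.continuousOn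
    refine ⟨K / N !, fun z hz => ?_⟩
    have h := norm_sub_le_of_rayDeriv_eq_zero (hu.of_le (natCast_le_infty _)) hK
      (fun j hj _ v => H' j hj v) (mem_closedBall_zero_iff.mp hz)
    calc ‖u z - u 0‖ ≤ K * ‖z‖ ^ (N + 1) / N ! := h
      _ = K / N ! * ‖z‖ ^ (N + 1) := by ring
  -- frame reduction of `∂_y (u - u 0) = J(u) ∂ₓ (u - u 0)`
  have hU : ball (0 : ℂ) R₀ ∈ 𝓝 (0 : ℂ) := ball_mem_nhds 0 hR₀
  have hJt : ContDiffOn ℝ ∞ (fun z => J (u z)) (ball 0 R₀) := (hJ.comp hu).contDiffOn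
  have hw₀ : ContDiffOn ℝ ∞ (fun z => u z - u 0) (ball 0 R₀) :=
    (hu.sub contDiff_const).contDiffOn
  have heq : ∀ z ∈ ball (0 : ℂ) R₀, fderiv ℝ (fun z => u z - u 0) z I =
      J (u z) (fderiv ℝ (fun z => u z - u 0) z 1) + (0 : G →L[ℝ] G) (u z - u 0) := by
    intro z hz
    rw [fderiv_sub_const, zero_apply, add_zero]
    have h := hhol z hz 1
    rwa [mul_one] at h
  obtain ⟨R, C, M, Φ, Ψ, hR, -, hM, hRU, -, -, -, -, -, -, hws, hineq, hcmp⟩ :=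
    FrameReduction.exists_frame hU hJt (fun z _ v => hJ2 (u z) v) hJ0 hw₀
      continuousOn_const heq
  -- the holomorphic comparison function and its flatness
  obtain ⟨ρ₂, hρ₂, hρ₂R, c₁, c₂, Hc, hc₁, hHd, hH⟩ :=
    Literature.Analysis.Complex.exists_holomorphic_comparison_of_norm_dbar_le_normedSpace
      hR hws hineq
  have hHflat : ∀ N : ℕ, ∃ C' : ℝ, ∀ z ∈ ball (0 : ℂ) (min ρ₂ 1), ‖Hc z‖ ≤ C' * ‖z‖ ^ (N + 1) := by
    intro N
    obtain ⟨CN, hCN⟩ := hflat N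
    refine ⟨max c₂ 0 * (M * CN), fun z hz => ?_⟩
    have hzρ : z ∈ ball (0 : ℂ) ρ₂ := ball_subset_ball (min_le_left _ _) hz
    have hz1 : z ∈ closedBall (0 : ℂ) 1 :=
      ball_subset_closedBall (ball_subset_ball (min_le_right _ _) hz)
    have hzR : z ∈ ball (0 : ℂ) R := ball_subset_ball hρ₂R.le hzρ
    calc ‖Hc z‖ ≤ c₂ * ‖Ψ z (u z - u 0)‖ := (hH z hzρ).2
      _ ≤ max c₂ 0 * ‖Ψ z (u z - u 0)‖ :=
          mul_le_mul_of_nonneg_right (le_max_left _ _) (norm_nonneg _)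
      _ ≤ max c₂ 0 * (M * ‖u z - u 0‖) := by gcongr; exact (hcmp z hzR).1
      _ ≤ max c₂ 0 * (M * (CN * ‖z‖ ^ (N + 1))) := by gcongr; exact hCN z hz1
      _ = max c₂ 0 * (M * CN) * ‖z‖ ^ (N + 1) := by ring
  -- an analytic function flat at `0` vanishes near `0`
  have hHan : AnalyticAt ℂ Hc 0 := hHd.analyticAt (ball_mem_nhds 0 hρ₂)
  have hH0 : ∀ᶠ z in 𝓝 (0 : ℂ), Hc z = 0 := by
    by_contra hne
    obtain ⟨m, g, hg, hg0, hfg⟩ := hHan.exists_eventuallyEq_pow_smul_nonzero_iff.mpr hne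
    obtain ⟨C', hC'⟩ := hHflat m
    -- `‖g z‖ ≤ C' ‖z‖` on a punctured neighbourhood of `0`, so `g 0 = 0`
    have hgle : ∀ᶠ z in 𝓝[≠] (0 : ℂ), ‖g z‖ ≤ C' * ‖z‖ := by
      have hb : ∀ᶠ z in 𝓝 (0 : ℂ), z ∈ ball (0 : ℂ) (min ρ₂ 1) :=
        ball_mem_nhds 0 (lt_min hρ₂ one_pos)
      have h1 : ∀ᶠ z in 𝓝[≠] (0 : ℂ), Hc z = (z - 0) ^ m • g z ∧ z ∈ ball (0 : ℂ) (min ρ₂ 1) :=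
        (hfg.and hb).filter_mono nhdsWithin_le_nhds
      have h2 : ∀ᶠ z in 𝓝[≠] (0 : ℂ), z ≠ 0 := self_mem_nhdsWithin
      filter_upwards [h1, h2] with z hz hz0
      obtain ⟨hz, hzb⟩ := hz
      have h3 := hC' z hzb
      rw [hz, sub_zero, norm_smul, norm_pow, pow_succ] at h3
      have hpos : 0 < ‖z‖ ^ m := pow_pos (norm_pos_iff.mpr hz0) m
      have h4 : ‖g z‖ * ‖z‖ ^ m ≤ C' * ‖z‖ * ‖z‖ ^ m := by nlinarith [h3]
      exact le_of_mul_le_mul_right h4 hpos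
    have hg0' : g 0 = 0 := by
      have hcont : Tendsto (fun z => ‖g z‖) (𝓝[≠] (0 : ℂ)) (𝓝 ‖g 0‖) :=
        (hg.continuousAt.norm.tendsto).mono_left nhdsWithin_le_nhds
      have hlim : Tendsto (fun z : ℂ => C' * ‖z‖) (𝓝[≠] (0 : ℂ)) (𝓝 0) := by
        have : Tendsto (fun z : ℂ => C' * ‖z‖) (𝓝 0) (𝓝 (C' * ‖(0 : ℂ)‖)) :=
          tendsto_const_nhds.mul continuous_norm.continuousAt
        rw [norm_zero, mul_zero] at this
        exact this.mono_left nhdsWithin_le_nhds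
      have h := le_of_tendsto_of_tendsto hcont hlim hgle
      exact norm_le_zero_iff.mp h
    exact hg0 hg0'
  -- hence `u ≡ u 0` near `0`: contradiction
  have hu0 : ∀ᶠ z in 𝓝 (0 : ℂ), u z = u 0 := by
    have hb : ∀ᶠ z in 𝓝 (0 : ℂ), z ∈ ball (0 : ℂ) ρ₂ := ball_mem_nhds 0 hρ₂
    filter_upwards [hH0, hb] with z hz hzb
    have hzR : z ∈ ball (0 : ℂ) R := ball_subset_ball hρ₂R.le hzb
    have h1 := (hH z hzb).1
    rw [hz, norm_zero] at h1
    have hw : ‖Ψ z (u z - u 0)‖ = 0 :=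
      le_antisymm (by nlinarith [norm_nonneg (Ψ z (u z - u 0))]) (norm_nonneg _)
    have h2 := (hcmp z hzR).2
    rw [hw, mul_zero] at h2
    exact sub_eq_zero.mp (norm_le_zero_iff.mp h2)
  obtain ⟨z, hz1, hz2⟩ := (hnc.and_eventually hu0).exists
  exact hz1 hz2

end FiniteOrder

/-! ### Auxiliary one-variable calculus -/

/-- Collapsing the Taylor sum along a ray when the terms of orders `1 ≤ j ≤ k'` vanish
(value level). [folklore] -/
theorem raySum_collapse {u : ℂ → G} {k' : ℕ} {z : ℂ}
    (h : ∀ j : ℕ, 1 ≤ j → j < k' + 1 → iteratedDeriv j (rayFun u z) 0 = 0) :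
    ∑ j ∈ range (k' + 1 + 1), ((j ! : ℝ)⁻¹) • iteratedDeriv j (rayFun u z) 0 =
      u 0 + (((k' + 1)! : ℝ)⁻¹) • iteratedDeriv (k' + 1) (rayFun u z) 0 := by
  rw [sum_range_succ, sum_range_succ']
  have h0 : ∑ j ∈ range k', (((j + 1)! : ℝ)⁻¹) • iteratedDeriv (j + 1) (rayFun u z) 0 = 0 :=
    sum_eq_zero fun j hj => by
      rw [h (j + 1) (Nat.succ_le_succ (Nat.zero_le j))
        (by have := mem_range.mp hj; omega), smul_zero]
  have h1 : iteratedDeriv 0 (rayFun u z) 0 = u 0 := by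
    rw [iteratedDeriv_zero]
    show u ((0 : ℝ) • z) = u 0
    rw [zero_smul]
  rw [h0, zero_add, h1, Nat.factorial_zero, Nat.cast_one, inv_one, one_smul]

/-- Collapsing the Taylor sum along a ray when the terms of orders `1 ≤ j ≤ k'` vanish
(derivative level). [folklore] -/
theorem raySum_collapse_succ {u : ℂ → G} {k' : ℕ} {z : ℂ}
    (h : ∀ j : ℕ, 1 ≤ j → j < k' + 1 → iteratedDeriv j (rayFun u z) 0 = 0) :
    ∑ j ∈ range (k' + 1), ((j ! : ℝ)⁻¹) • iteratedDeriv (j + 1) (rayFun u z) 0 =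
      ((k' ! : ℝ)⁻¹) • iteratedDeriv (k' + 1) (rayFun u z) 0 := by
  rw [sum_range_succ]
  have h0 : ∑ j ∈ range k', ((j ! : ℝ)⁻¹) • iteratedDeriv (j + 1) (rayFun u z) 0 = 0 :=
    sum_eq_zero fun j hj => by
      rw [h (j + 1) (Nat.succ_le_succ (Nat.zero_le j))
        (by have := mem_range.mp hj; omega), smul_zero]
  rw [h0, zero_add]

/-- Derivative of the circle parametrisation `θ ↦ r e^{iθ}`. [folklore] -/
theorem hasDerivAt_circleParam (r θ : ℝ) :
    HasDerivAt (fun θ : ℝ => (r : ℂ) * cexp (θ * I)) ((r : ℂ) * cexp (θ * I) * I) θ := by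
  have h1 : HasDerivAt (fun θ : ℝ => (θ : ℂ) * I) I θ := by
    simpa using ((hasDerivAt_id θ).ofReal_comp).mul_const I
  have h2 := (h1.cexp).const_mul (r : ℂ)
  simpa [mul_assoc] using h2

/-- The angular derivative of `u` along the circle of radius `r`. [folklore] -/
theorem hasDerivAt_comp_circleParam {u : ℂ → G} (hu : Differentiable ℝ u) (r θ : ℝ) :
    HasDerivAt (fun θ : ℝ => u ((r : ℂ) * cexp (θ * I)))
      (fderiv ℝ u ((r : ℂ) * cexp (θ * I)) ((r : ℂ) * cexp (θ * I) * I)) θ :=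
  (hu _).hasFDerivAt.comp_hasDerivAt θ (hasDerivAt_circleParam r θ)

/-- `‖r e^{iθ}‖ = r` for `r ≥ 0`. [folklore] -/
theorem norm_circleParam {r : ℝ} (hr : 0 ≤ r) (θ : ℝ) : ‖(r : ℂ) * cexp (θ * I)‖ = r := by
  rw [norm_mul, Complex.norm_of_nonneg hr, Complex.norm_exp_ofReal_mul_I, mul_one]

/-- The circle parametrisation is continuous in the angle. [folklore] -/
theorem continuous_circleParam (r : ℝ) : Continuous fun θ : ℝ => (r : ℂ) * cexp (θ * I) :=
  continuous_const.mul (Complex.continuous_exp.comp (Complex.continuous_ofReal.mul continuous_const))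

/-- **Linear ODE on the line.** A continuous `n : ℝ → G` with `n θ = n 0 + μ • ∫₀^θ n` is
`θ ↦ e^{μ θ} • n 0`. [folklore] -/
theorem eq_exp_smul_of_integral_eq [CompleteSpace G] {n : ℝ → G} (hn : Continuous n) (μ : ℂ)
    (h : ∀ θ : ℝ, n θ = n 0 + μ • ∫ s in (0 : ℝ)..θ, n s) (θ : ℝ) :
    n θ = cexp (μ * θ) • n 0 := by
  -- `n` solves `n' = μ n`
  have hd : ∀ θ : ℝ, HasDerivAt n (μ • n θ) θ := by
    intro θ
    have h1 : HasDerivAt (fun θ : ℝ => ∫ s in (0 : ℝ)..θ, n s) (n θ) θ :=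
      integral_hasDerivAt_right (hn.intervalIntegrable _ _) (hn.stronglyMeasurableAtFilter _ _)
        hn.continuousAt
    have h2 : HasDerivAt (fun θ : ℝ => n 0 + μ • ∫ s in (0 : ℝ)..θ, n s) (μ • n θ) θ :=
      (h1.fun_const_smul μ).const_add (n 0)
    have h3 : (fun θ : ℝ => n 0 + μ • ∫ s in (0 : ℝ)..θ, n s) = n := funext fun θ => (h θ).symm
    rwa [h3] at h2
  -- `θ ↦ e^{-μθ} • n θ` is constant
  have hm : ∀ θ : ℝ, HasDerivAt (fun θ : ℝ => cexp (-(μ * θ)) • n θ) 0 θ := by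
    intro θ
    have he : HasDerivAt (fun θ : ℝ => cexp (-(μ * θ))) (cexp (-(μ * θ)) * -μ) θ := by
      have h0 : HasDerivAt (fun θ : ℝ => μ * (θ : ℂ)) μ θ := by
        simpa using (hasDerivAt_id θ).ofReal_comp.const_mul μ
      exact h0.fun_neg.cexp
    have h := he.fun_smul (hd θ)
    convert h using 1
    rw [smul_smul, ← add_smul, mul_neg, add_neg_cancel, zero_smul]
  have hconst := is_const_of_deriv_eq_zero (fun θ => (hm θ).differentiableAt)
    (fun θ => (hm θ).deriv)
  have h0 := hconst θ 0
  simp only [ofReal_zero, mul_zero, neg_zero, Complex.exp_zero, one_smul] at h0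
  calc n θ = cexp (μ * θ) • (cexp (-(μ * θ)) • n θ) := by
        rw [smul_smul, ← Complex.exp_add, add_neg_cancel, Complex.exp_zero, one_smul]
    _ = cexp (μ * θ) • n 0 := by rw [h0]

/-- **The limiting angular identity.** If `u(z) - u(0) = D(z)/(k'+1)! + O(|z|^{k'+2})`,
`J(u(z)) (Du(z) z) = i D(z)/k'! + O(|z|^{k'+2})`, `D(r e^{iθ}) = r^{k'+1} n(θ)` and
`∂_θ [u(r e^{iθ})] = J(u) (Du · z)` (the polar form of the `J`-holomorphicity equation), then
`(n(θ₁) - n(0))/(k'+1)! = (i/k'!) ∫₀^{θ₁} n`. [folklore] -/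
theorem angular_integral_identity [CompleteSpace G] {u : ℂ → G} {J : G → G →L[ℝ] G} {D : ℂ → G}
    {n : ℝ → G}
    {k' : ℕ} {R₁ C₁ C₃ : ℝ} (hR₁ : 0 < R₁) (hud : Differentiable ℝ u)
    (hcontF : Continuous fun z : ℂ => J (u z) (fderiv ℝ u z z))
    (hpolar : ∀ z : ℂ, ‖z‖ ≤ R₁ → fderiv ℝ u z (I * z) = J (u z) (fderiv ℝ u z z))
    (hDpolar : ∀ r θ : ℝ, D ((r : ℂ) * cexp (θ * I)) = ((r : ℂ) ^ (k' + 1)) • n θ)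
    (hn : Continuous n)
    (hE1 : ∀ z : ℂ, ‖z‖ ≤ R₁ →
      ‖u z - u 0 - (((k' + 1)! : ℝ)⁻¹) • D z‖ ≤ C₁ * ‖z‖ ^ (k' + 1 + 1))
    (hE3 : ∀ z : ℂ, ‖z‖ ≤ R₁ →
      ‖J (u z) (fderiv ℝ u z z) - I • (((k' ! : ℝ)⁻¹) • D z)‖ ≤ C₃ * ‖z‖ ^ (k' + 1 + 1))
    (θ₁ : ℝ) :
    (((k' + 1)! : ℝ)⁻¹) • (n θ₁ - n 0) = I • (((k' ! : ℝ)⁻¹) • ∫ s in (0 : ℝ)..θ₁, n s) := by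
  set X : G := (((k' + 1)! : ℝ)⁻¹) • (n θ₁ - n 0) - I • (((k' ! : ℝ)⁻¹) • ∫ s in (0 : ℝ)..θ₁, n s)
    with hX
  -- the main estimate: `‖X‖ ≤ (2 C₁ + C₃ |θ₁|) r` for `0 < r ≤ R₁`
  have hmain : ∀ r : ℝ, 0 < r → r ≤ R₁ → ‖X‖ ≤ (2 * C₁ + C₃ * |θ₁|) * r := by
    intro r hr hrR
    set z : ℝ → ℂ := fun θ => (r : ℂ) * cexp (θ * I) with hz
    have hzn : ∀ θ, ‖z θ‖ = r := fun θ => norm_circleParam hr.le θ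
    have hzR : ∀ θ, ‖z θ‖ ≤ R₁ := fun θ => (hzn θ).le.trans hrR
    set F : ℝ → G := fun θ => J (u (z θ)) (fderiv ℝ u (z θ) (z θ)) with hF
    have hFc : Continuous F := hcontF.comp (continuous_circleParam r)
    -- `θ ↦ u (z θ)` has derivative `F`
    have hderiv : ∀ θ : ℝ, HasDerivAt (fun θ : ℝ => u (z θ)) (F θ) θ := by
      intro θ
      have h := hasDerivAt_comp_circleParam hud r θ
      have h2 : fderiv ℝ u (z θ) (z θ * I) = F θ := by
        rw [mul_comm (z θ) I]
        exact hpolar (z θ) (hzR θ)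
      rw [← h2]
      exact h
    have hint : ∫ θ in (0 : ℝ)..θ₁, F θ = u (z θ₁) - u (z 0) :=
      integral_eq_sub_of_hasDerivAt (fun θ _ => hderiv θ) (hFc.intervalIntegrable _ _)
    -- the approximating integrand `g θ = i D(z θ)/k'! = i r^{k'+1} n(θ)/k'!`
    set g : ℝ → G := fun θ => I • (((k' ! : ℝ)⁻¹) • (((r : ℂ) ^ (k' + 1)) • n θ)) with hg
    have hgc : Continuous g := ((hn.const_smul _).const_smul _).const_smul _
    have hgint : ∫ θ in (0 : ℝ)..θ₁, g θ =
        I • (((k' ! : ℝ)⁻¹) • (((r : ℂ) ^ (k' + 1)) • ∫ θ in (0 : ℝ)..θ₁, n θ)) := by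
      simp only [hg, intervalIntegral.integral_smul]
    have hFg : ∀ θ, ‖F θ - g θ‖ ≤ C₃ * r ^ (k' + 1 + 1) := by
      intro θ
      have h := hE3 (z θ) (hzR θ)
      rw [hDpolar r θ, hzn θ] at h
      exact h
    have hdiff : ‖(u (z θ₁) - u (z 0)) - I • (((k' ! : ℝ)⁻¹) • (((r : ℂ) ^ (k' + 1)) •
        ∫ θ in (0 : ℝ)..θ₁, n θ))‖ ≤ C₃ * r ^ (k' + 1 + 1) * |θ₁| := by
      rw [← hint, ← hgint, ← intervalIntegral.integral_sub (hFc.intervalIntegrable _ _)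
        (hgc.intervalIntegrable _ _)]
      have h := intervalIntegral.norm_integral_le_of_norm_le_const (a := (0 : ℝ)) (b := θ₁)
        (f := fun θ => F θ - g θ) (C := C₃ * r ^ (k' + 1 + 1)) (fun θ _ => hFg θ)
      rwa [sub_zero] at h
    -- the two Taylor estimates at `z θ₁` and `z 0 = r`
    have he₁ := hE1 (z θ₁) (hzR θ₁)
    rw [hDpolar r θ₁, hzn θ₁] at he₁
    have he₀ := hE1 (z 0) (hzR 0)
    rw [hDpolar r 0, hzn 0] at he₀
    -- assemble
    have hid : ((r : ℂ) ^ (k' + 1)) • X =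
        -(u (z θ₁) - u 0 - (((k' + 1)! : ℝ)⁻¹) • (((r : ℂ) ^ (k' + 1)) • n θ₁)) +
          (u (z 0) - u 0 - (((k' + 1)! : ℝ)⁻¹) • (((r : ℂ) ^ (k' + 1)) • n 0)) +
          ((u (z θ₁) - u (z 0)) - I • (((k' ! : ℝ)⁻¹) • (((r : ℂ) ^ (k' + 1)) •
            ∫ θ in (0 : ℝ)..θ₁, n θ))) := by
      simp only [hX, ← Complex.coe_smul]
      module
    have hnorm : ‖((r : ℂ) ^ (k' + 1)) • X‖ = r ^ (k' + 1) * ‖X‖ := by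
      rw [norm_smul, norm_pow, Complex.norm_of_nonneg hr.le]
    have hle : ‖((r : ℂ) ^ (k' + 1)) • X‖ ≤ r ^ (k' + 1) * ((2 * C₁ + C₃ * |θ₁|) * r) := by
      rw [hid]
      calc _ ≤ ‖-(u (z θ₁) - u 0 - (((k' + 1)! : ℝ)⁻¹) • (((r : ℂ) ^ (k' + 1)) • n θ₁)) +
              (u (z 0) - u 0 - (((k' + 1)! : ℝ)⁻¹) • (((r : ℂ) ^ (k' + 1)) • n 0))‖ +
            ‖(u (z θ₁) - u (z 0)) - I • (((k' ! : ℝ)⁻¹) • (((r : ℂ) ^ (k' + 1)) •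
              ∫ θ in (0 : ℝ)..θ₁, n θ))‖ := norm_add_le _ _
        _ ≤ (C₁ * r ^ (k' + 1 + 1) + C₁ * r ^ (k' + 1 + 1)) + C₃ * r ^ (k' + 1 + 1) * |θ₁| := by
            gcongr
            · exact (norm_add_le _ _).trans (by rw [norm_neg]; exact add_le_add he₁ he₀)
        _ = r ^ (k' + 1) * ((2 * C₁ + C₃ * |θ₁|) * r) := by ring
    rw [hnorm] at hle
    exact le_of_mul_le_mul_left hle (pow_pos hr _)
  -- let `r → 0⁺`
  have hX0 : ‖X‖ ≤ 0 := by
    have hlim : Tendsto (fun r : ℝ => (2 * C₁ + C₃ * |θ₁|) * r) (𝓝[>] (0 : ℝ)) (𝓝 0) := by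
      have : Tendsto (fun r : ℝ => (2 * C₁ + C₃ * |θ₁|) * r) (𝓝 (0 : ℝ))
          (𝓝 ((2 * C₁ + C₃ * |θ₁|) * 0)) := tendsto_const_nhds.mul tendsto_id
      rw [mul_zero] at this
      exact this.mono_left nhdsWithin_le_nhds
    have hev : ∀ᶠ r in 𝓝[>] (0 : ℝ), ‖X‖ ≤ (2 * C₁ + C₃ * |θ₁|) * r := by
      filter_upwards [Ioc_mem_nhdsGT hR₁] with r hr
      exact hmain r hr.1 hr.2
    exact ge_of_tendsto hlim hev
  have hX0' : X = 0 := norm_le_zero_iff.mp hX0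
  exact sub_eq_zero.mp hX0'

/-! ### The order and the leading term -/

section Order

variable [FiniteDimensional ℂ G]

/-- **Order and leading term of a `J`-holomorphic curve at a point** (McDuff 1991, proof of
Prop. 2.6, p. 149; Wendl 2020, Cor. B.21 / Remark B.22). Let `u : ℂ → G` be smooth and
`J`-holomorphic on `B(0, R₀)` for a smooth almost complex structure `J` on `G` with `J (u 0) = i`,
not locally constant at `0`. Then there are `k ≥ 1` and `a ≠ 0` with
`(d/dt)^j u(tv)|₀ = 0` for `1 ≤ j < k` and `(d/dt)^k u(tv)|₀ = k! vᵏ • a` for all `v ∈ ℂ`: the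
Taylor expansion of `u - u 0` at `0` begins with the holomorphic term `zᵏ • a`.
[cite: McDuff1991LocalBehaviour, Prop. 2.6 (proof, p. 149)] -/
theorem exists_order {J : G → G →L[ℝ] G} {u : ℂ → G} {R₀ : ℝ} (hR₀ : 0 < R₀)
    (hJ : ContDiff ℝ ∞ J) (hJ2 : ∀ x v, J x (J x v) = -v) (hu : ContDiff ℝ ∞ u)
    (hhol : ∀ z ∈ ball (0 : ℂ) R₀, ∀ ζ : ℂ, fderiv ℝ u z (I * ζ) = J (u z) (fderiv ℝ u z ζ))
    (hJ0 : ∀ v, J (u 0) v = I • v) (hnc : ∃ᶠ z in 𝓝 (0 : ℂ), u z ≠ u 0) :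
    ∃ (k : ℕ) (a : G), 1 ≤ k ∧ a ≠ 0 ∧
      (∀ j : ℕ, 1 ≤ j → j < k → ∀ v : ℂ, iteratedDeriv j (rayFun u v) 0 = 0) ∧
      (∀ v : ℂ, iteratedDeriv k (rayFun u v) 0 = ((k ! : ℂ) * v ^ k) • a) := by
  classical
  haveI : CompleteSpace G := FiniteDimensional.complete ℂ G
  have hex : ∃ j : ℕ, 1 ≤ j ∧ ∃ v : ℂ, ‖v‖ = 1 ∧ iteratedDeriv j (rayFun u v) 0 ≠ 0 := by
    obtain ⟨j, v, hj, hv, hne⟩ := exists_rayDeriv_ne_zero hR₀ hJ hJ2 hu hhol hJ0 hnc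
    exact ⟨j, hj, v, hv, hne⟩
  obtain ⟨k, ⟨hk1, v₀, hv₀, hv₀ne⟩, hkmin⟩ :
      ∃ k, (1 ≤ k ∧ ∃ v : ℂ, ‖v‖ = 1 ∧ iteratedDeriv k (rayFun u v) 0 ≠ 0) ∧
        ∀ j, j < k → ¬ (1 ≤ j ∧ ∃ v : ℂ, ‖v‖ = 1 ∧ iteratedDeriv j (rayFun u v) 0 ≠ 0) :=
    ⟨Nat.find hex, Nat.find_spec hex, fun j hj => Nat.find_min hex hj⟩
  have hmin : ∀ j : ℕ, 1 ≤ j → j < k → ∀ v : ℂ, iteratedDeriv j (rayFun u v) 0 = 0 := by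
    intro j hj hjk
    have h := hkmin j hjk
    push Not at h
    exact rayDeriv_eq_zero_of_unit hu hj (h hj)
  obtain ⟨k', rfl⟩ : ∃ k', k = k' + 1 := ⟨k - 1, by omega⟩
  -- the top ray derivative `D` and the angular function `n`
  set D : ℂ → G := fun v => iteratedDeriv (k' + 1) (rayFun u v) 0 with hD
  set n : ℝ → G := fun θ => D (cexp (θ * I)) with hn
  have hDsmul : ∀ (s : ℝ) (v : ℂ), D ((s : ℂ) * v) = ((s : ℂ) ^ (k' + 1)) • D v := by
    intro s v
    have h := iteratedDeriv_rayFun_smul_zero hu v (natCast_le_infty (k' + 1)) s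
    rw [Complex.real_smul, ← Complex.coe_smul, Complex.ofReal_pow] at h
    exact h
  have hDpolar : ∀ r θ : ℝ, D ((r : ℂ) * cexp (θ * I)) = ((r : ℂ) ^ (k' + 1)) • n θ :=
    fun r θ => hDsmul r _
  have hDbound : ∀ v, ‖D v‖ ≤ ‖iteratedFDeriv ℝ (k' + 1) u 0‖ * ‖v‖ ^ (k' + 1) :=
    norm_iteratedDeriv_rayFun_zero_le hu (k' + 1)
  have hn_cont : Continuous n := by
    have h1 : n = fun θ : ℝ => iteratedFDeriv ℝ (k' + 1) u 0 (fun _ => cexp (θ * I)) :=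
      funext fun θ => iteratedDeriv_rayFun_zero_eq hu (k' + 1) _
    rw [h1]
    exact (iteratedFDeriv ℝ (k' + 1) u 0).cont.comp
      (continuous_pi fun _ => Complex.continuous_exp.comp
        (Complex.continuous_ofReal.mul continuous_const))
  -- (E1), (E2): Taylor along rays on the unit disc; all intermediate terms vanish
  obtain ⟨K₁, hK₁⟩ : ∃ K₁, ∀ x ∈ closedBall (0 : ℂ) 1,
      ‖iteratedFDeriv ℝ (k' + 1 + 1) u x‖ ≤ K₁ :=
    (isCompact_closedBall (0 : ℂ) 1).exists_bound_of_continuousOn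
      ((hu.continuous_iteratedFDeriv (natCast_le_infty _)).continuousOn)
  have hE1 : ∀ z : ℂ, ‖z‖ ≤ 1 →
      ‖u z - u 0 - (((k' + 1)! : ℝ)⁻¹) • D z‖ ≤ K₁ / (k' + 1)! * ‖z‖ ^ (k' + 1 + 1) := by
    intro z hz
    have h := norm_sub_raySum_le (N := k' + 1) (hu.of_le (natCast_le_infty _)) hK₁ hz
    rw [raySum_collapse (fun j hj hjk => hmin j hj hjk z), ← sub_sub] at h
    calc _ ≤ K₁ * ‖z‖ ^ (k' + 1 + 1) / (k' + 1)! := h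
      _ = K₁ / (k' + 1)! * ‖z‖ ^ (k' + 1 + 1) := by ring
  have hE2 : ∀ z : ℂ, ‖z‖ ≤ 1 →
      ‖fderiv ℝ u z z - ((k' ! : ℝ)⁻¹) • D z‖ ≤ K₁ / k' ! * ‖z‖ ^ (k' + 1 + 1) := by
    intro z hz
    have h := norm_fderiv_sub_raySum_le (N := k') (hu.of_le (natCast_le_infty _)) hK₁ hz
    rw [raySum_collapse_succ (fun j hj hjk => hmin j hj hjk z)] at h
    calc _ ≤ K₁ * ‖z‖ ^ (k' + 2) / k' ! := h
      _ = K₁ / k' ! * ‖z‖ ^ (k' + 1 + 1) := by ring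
  -- (E3): `J(u z)(Du(z) z) = i D(z)/k'! + O(|z|^{k'+2})`
  obtain ⟨MJ, hMJ⟩ : ∃ MJ, ∀ z ∈ closedBall (0 : ℂ) 1, ‖J (u z)‖ ≤ MJ :=
    (isCompact_closedBall (0 : ℂ) 1).exists_bound_of_continuousOn
      ((hJ.continuous.comp hu.continuous).continuousOn)
  obtain ⟨L, hL⟩ : ∃ L, ∀ z ∈ closedBall (0 : ℂ) 1, ‖J (u z) - J (u 0)‖ ≤ L * ‖z‖ := by
    have hc : ContDiff ℝ 1 (fun z => J (u z)) := (hJ.comp hu).of_le (by exact_mod_cast le_top)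
    obtain ⟨L, hL⟩ := (isCompact_closedBall (0 : ℂ) 1).exists_bound_of_continuousOn
      ((hc.continuous_fderiv one_ne_zero).continuousOn)
    refine ⟨L, fun z hz => ?_⟩
    have h := (convex_closedBall (0 : ℂ) 1).norm_image_sub_le_of_norm_fderiv_le
      (fun x _ => hc.differentiable one_ne_zero x) hL (mem_closedBall_self zero_le_one) hz
    simpa using h
  have hMJ0 : 0 ≤ MJ := (norm_nonneg _).trans (hMJ 0 (mem_closedBall_self zero_le_one))
  have hL0 : 0 ≤ L := by
    have h := hL 1 (by simp)
    rw [norm_one, mul_one] at h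
    exact (norm_nonneg _).trans h
  set K₀ : ℝ := ‖iteratedFDeriv ℝ (k' + 1) u 0‖ with hK₀
  have hE3 : ∀ z : ℂ, ‖z‖ ≤ 1 →
      ‖J (u z) (fderiv ℝ u z z) - I • (((k' ! : ℝ)⁻¹) • D z)‖ ≤
        (MJ * (K₁ / k' !) + L * ((k' ! : ℝ)⁻¹ * K₀)) * ‖z‖ ^ (k' + 1 + 1) := by
    intro z hz
    have hz' : z ∈ closedBall (0 : ℂ) 1 := mem_closedBall_zero_iff.mpr hz
    have hsplit : J (u z) (fderiv ℝ u z z) - I • (((k' ! : ℝ)⁻¹) • D z) =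
        J (u z) (fderiv ℝ u z z - ((k' ! : ℝ)⁻¹) • D z) +
          (J (u z) - J (u 0)) (((k' ! : ℝ)⁻¹) • D z) := by
      rw [map_sub, _root_.sub_apply, hJ0]
      abel
    rw [hsplit]
    calc _ ≤ ‖J (u z) (fderiv ℝ u z z - ((k' ! : ℝ)⁻¹) • D z)‖ +
          ‖(J (u z) - J (u 0)) (((k' ! : ℝ)⁻¹) • D z)‖ := norm_add_le _ _
      _ ≤ MJ * (K₁ / k' ! * ‖z‖ ^ (k' + 1 + 1)) +
          L * ‖z‖ * ((k' ! : ℝ)⁻¹ * (K₀ * ‖z‖ ^ (k' + 1))) := by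
          gcongr
          · exact (ContinuousLinearMap.le_opNorm _ _).trans
              (mul_le_mul (hMJ z hz') (hE2 z hz) (norm_nonneg _) hMJ0)
          · refine (ContinuousLinearMap.le_opNorm _ _).trans
              (mul_le_mul (hL z hz') ?_ (norm_nonneg _) (mul_nonneg hL0 (norm_nonneg _)))
            rw [norm_smul, norm_inv, Real.norm_natCast]
            gcongr
            exact hDbound z
      _ = (MJ * (K₁ / k' !) + L * ((k' ! : ℝ)⁻¹ * K₀)) * ‖z‖ ^ (k' + 1 + 1) := by ring
  -- polar form of the equation and continuity of its right-hand side
  set R₁ : ℝ := min 1 (R₀ / 2) with hR₁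
  have hR₁pos : 0 < R₁ := lt_min one_pos (half_pos hR₀)
  have hR₁1 : R₁ ≤ 1 := min_le_left _ _
  have hR₁R₀ : R₁ < R₀ := (min_le_right _ _).trans_lt (half_lt_self hR₀)
  have hud : Differentiable ℝ u := hu.differentiable (by simp)
  have hpolar : ∀ z : ℂ, ‖z‖ ≤ R₁ → fderiv ℝ u z (I * z) = J (u z) (fderiv ℝ u z z) :=
    fun z hz => hhol z (mem_ball_zero_iff.mpr (hz.trans_lt hR₁R₀)) z
  have hcontF : Continuous fun z : ℂ => J (u z) (fderiv ℝ u z z) := by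
    have h1 : Continuous fun z : ℂ => J (u z) := hJ.continuous.comp hu.continuous
    have h2 : Continuous fun z : ℂ => fderiv ℝ u z z :=
      (hu.continuous_fderiv (by simp)).clm_apply continuous_id
    exact h1.clm_apply h2
  -- the angular identity, hence the ODE `n' = (k'+1) i n`
  have hid : ∀ θ₁ : ℝ, (((k' + 1)! : ℝ)⁻¹) • (n θ₁ - n 0) =
      I • (((k' ! : ℝ)⁻¹) • ∫ s in (0 : ℝ)..θ₁, n s) :=
    angular_integral_identity hR₁pos hud hcontF hpolar hDpolar hn_cont
      (fun z hz => hE1 z (hz.trans hR₁1)) (fun z hz => hE3 z (hz.trans hR₁1))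
  have hode : ∀ θ : ℝ, n θ = n 0 + (((k' + 1 : ℕ) : ℂ) * I) • ∫ s in (0 : ℝ)..θ, n s := by
    intro θ
    have h := congr_arg (fun x : G => (((k' + 1)! : ℕ) : ℂ) • x) (hid θ)
    simp only [← Complex.coe_smul, smul_smul] at h
    have h1 : (((k' + 1)! : ℕ) : ℂ) * ((((k' + 1)! : ℝ)⁻¹ : ℝ) : ℂ) = 1 := by
      push_cast
      exact mul_inv_cancel₀ (by exact_mod_cast Nat.factorial_ne_zero _)
    have h2 : (((k' + 1)! : ℕ) : ℂ) * (I * (((k' ! : ℝ)⁻¹ : ℝ) : ℂ)) =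
        ((k' + 1 : ℕ) : ℂ) * I := by
      have hk : ((k' ! : ℕ) : ℂ) ≠ 0 := by exact_mod_cast Nat.factorial_ne_zero _
      rw [Nat.factorial_succ]
      push_cast
      field_simp
    rw [h1, one_smul, h2] at h
    exact eq_add_of_sub_eq' h
  have hsol : ∀ θ : ℝ, n θ = cexp ((((k' + 1 : ℕ) : ℂ) * I) * θ) • n 0 :=
    eq_exp_smul_of_integral_eq hn_cont _ hode
  -- the leading coefficient
  refine ⟨k' + 1, (((k' + 1)! : ℂ))⁻¹ • n 0, le_add_self, ?_, hmin, ?_⟩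
  · -- `a ≠ 0` since `D v₀ ≠ 0`
    intro ha
    rw [smul_eq_zero, inv_eq_zero] at ha
    rcases ha with ha | ha
    · exact Nat.factorial_ne_zero _ (by exact_mod_cast ha)
    · apply hv₀ne
      have h1 : v₀ = ((‖v₀‖ : ℝ) : ℂ) * cexp (arg v₀ * I) := (norm_mul_exp_arg_mul_I v₀).symm
      show D v₀ = 0
      rw [h1, hDpolar, hsol, ha, smul_zero, smul_zero]
  · intro v
    have hk : (((k' + 1)! : ℕ) : ℂ) ≠ 0 := by exact_mod_cast Nat.factorial_ne_zero _
    rw [smul_smul, mul_comm (((k' + 1)! : ℕ) : ℂ) _, mul_assoc, mul_inv_cancel₀ hk, mul_one]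
    show D v = v ^ (k' + 1) • n 0
    by_cases hv : v = 0
    · rw [hv, zero_pow (Nat.succ_ne_zero _), zero_smul]
      exact iteratedDeriv_rayFun_dir_zero hu le_add_self
    · have h1 : v = ((‖v‖ : ℝ) : ℂ) * cexp (arg v * I) := (norm_mul_exp_arg_mul_I v).symm
      conv_lhs => rw [h1]
      rw [hDpolar, hsol, smul_smul]
      congr 1
      rw [mul_comm (((k' + 1 : ℕ) : ℂ) * I) _, ← mul_assoc, mul_comm _ ((k' + 1 : ℕ) : ℂ),
        mul_assoc, Complex.exp_nat_mul, ← mul_pow, ← h1]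

end Order


end CriticalOrder

end Literature.Geometry.Symplectic

end
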